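/-
Copyright (c) 2026 the pub-hodgecm-mathlib formalisation cell (harness21).  Prover seat hodgecm-mathlib-F0P3-p02 (g16), 2026-09-01.  Road «S3-ram» seeding wave (LEAD F0P3a-plan (g12) T11-41∕T11-54∕T11-57;
owner F0P3a-p06 (g15)), row «(L)-ram» file L5-C2: the `N ∩ K₃`-average of a `v`-level-one `K`-class piece obeying the TWO-LAYER (U)-ram head, tame-RAMIFIED place (the `hN` socket of ★ p846921).
-/
import Literature.NumberTheory.Automorphic.TorusTwoDeepLevelTwoStrataSplitRamified          -- ★ FILE L5-C1 (this seat): `apply_symm_torus_mul_levelTwo_values_split_of_ramified`, `redMat_smul_sub_one_eq_smul_of_rank_eq_one`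
import Literature.NumberTheory.Automorphic.HeisenbergLevelTwoStrataSplitIntegralRamified    -- ★ FILE L5-B (this seat, p847034): `integral_eq_of_levelTwo_strata_split_of_ramified`; ⊇ ★ FILE L5-A `isSquare_mul_iff_of_not_isSquare`, `ringChar_residueField_ne_two`
import Literature.NumberTheory.Automorphic.HeisenbergLevelOnePieceAverageRamified           -- ★ FILE L4 (this seat, p846975): `exists_torusU_regular_twoDeep_of_ramified`; ⊇ ★ p846915 `valued_symm_torus_sub_one_le`
import Literature.NumberTheory.Rogawski1990.LevelOnePieceDepthOneStrataValuesRamified       -- ★ p846992 (F0P3a-p05 (g16)): `redMat_placeForm_mul_depthOne_eq_transpose_mul_of_ramified` (`J̄′·N(k)` symmetric); ⊇ ★ `redMat_map_galAdicCompletionMap_eq_of_ramified`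
import Literature.NumberTheory.Automorphic.UnitaryGroupInertPlaceHyperbolicBasis            -- ★ `placeForm_hermitian_of_smul_eq` (place-free)
import HarnessLib

/-!
# The `N ∩ K₃`-average of a `v`-level-one `K`-class piece obeying the two-layer (U)-ram head at a TAME-RAMIFIED place: the `hN` socket of ★ p846921, SPLIT edition
(Rogawski (1990) §4.9 pp. 54–56, §12.2 p. 173; Kottwitz (1986) §3; Jacobowitz (1962) §5)

Topic `NumberTheory/Rogawski1990`; namespace `Literature.NumberTheory.Rogawski1990`.  KERNEL mathematics only: theorems, no definition, no named fact, no instance, no notation,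
no `sorry`.  Cell `pub/hodgecm-mathlib`, crux H413 = `stmt-HodgeConjecture-24833`; road «S3-ram» seeding wave (LEAD F0P3a-plan (g12); owner F0P3a-p06 (g15)), row **«(L)-ram», FILE L5-C2**
(seat F0P3-p02 (g16)).  CONSUMERS: the socket **`hN`** of F0P3a-p01 (g15)'s ★ p846921 `finsum_delta_mul_classOrbitalIntegral_eq_of_levi_ramified_levelOne_of_delta_eq` (ramified LEVI
clause (e3) of END F0P3a-p03 (g16)'s fold v6 `stub_levelOneRowsRam` :118), fed by the TWO-LAYER (U)-ram HEAD ★ `exists_twoLayerStrataValues_of_levelOne_ramified_of_not_isSquare`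
(F0P2-p01 (g15), rows (R1)(R2)(R3)(R4□)(R4ε)); ★ FILE L4 `integral_comp_symm_eq_of_levelOne_ramified` is the special case `c₁□ = c₁ε`.  HONEST LABEL: HC_CM is proved only modulo the
2 remaining named inputs (hLiu418 24832, h413 24833) until rung 0 closes; «S3-ram» is Literature seeding; this file discharges no named fact.

THE MATHEMATICS.  `v` non-split, TAMELY RAMIFIED (`e(w|v) ≠ 1`, `|2|_w = 1`, `q = N𝔭_v`); `H′` hermitian with `H′_w ∈ GL₃(𝒪_w)`; `ϖ ∈ L_w` with `|ϖ| = exp(−1)` and `σ_w ϖ = −ϖ`;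
`J̄′ := red(H′_w)` (SYMMETRIC: `σ̄_w = id`), `N(x) := red(ϖ⁻¹(x_w − 1))`.  `ψ : U(H′)_v ≃ U(Φ₃)_v` a level frame with integral matrix reading `(ψ x)_w = T x_w T⁻¹` (`T ∈ GL₃(𝒪_w)`),
`μ_N` ANY Haar measure of `N`, `g` supported in `K′`, left-invariant under the `v`-level-one congruence set (`hg1`, :118 VERBATIM), with the head values `c₂` (R1), `c′ 0, c′ 2` (R2)(R3)
and `c₁□ ∕ c₁ε` (R4□)∕(R4ε) on the rank-one interior stratum according as the NON-ZERO values of the residual quadratic form `z ↦ z ⬝ᵥ (J̄′ N(x)) *ᵥ z` are squares or not.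
For `n` in the rank-one interior stratum `I₁` of `N ∩ K₃` and `k = ψ⁻¹(t₁ n)` (`t₁` the auxiliary 2-deep regular torus element of ★ FILE L4): `N(k) = T̄⁻¹ N(n) T̄` (★ FILE L5-C1 §2),
`N(n) = β E₀₂` with `β = red(ϖ⁻¹(n_w)₀₂) ≠ 0` (★ FILE L5-C1 §1), so **`J̄′ N(k) = β · a ⊗ b`** with `a = J̄′ T̄⁻¹ e₀ ≠ 0`, `b = row₂(T̄) ≠ 0` (§1); this matrix is SYMMETRIC
(★ `redMat_placeForm_mul_depthOne_eq_transpose_mul_of_ramified`: the `𝔭`-layer), hence `a ∥ b` and the form is `β λ (b ⬝ᵥ z)²` with the FRAME CONSTANT `λ = a_{j₀}/b_{j₀} ≠ 0`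
INDEPENDENT of `n`: its non-zero values lie in the square class of `βλ`.  Therefore `g(ψ⁻¹ n) = c₁□` on `{β λ ∈ (𝓀^×)²}` and `c₁ε` on the complement — i.e. the two values sit on
the two residue-square-class HALVES `I₁^±` of ★ FILE L5-A in one order or the other (according as `λ` is a square), and the halves have EQUAL Haar measure (★ FILE L5-B).  Hence
**`∫_N g(ψ⁻¹ n) dμ_N = μ_N(N ∩ K₃)·(c₂(1 − q⁻¹) + q⁻¹·(c′ 2·(1 − q⁻¹) + ½(c₁□ + c₁ε)·q⁻¹(1 − q⁻¹) + c′ 0·q⁻²))`** (`integral_comp_symm_eq_of_levelOne_split_ramified`) — the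
`hN` socket of ★ p846921 with THAT `X`, for every frame `(ψ, T)` and every Haar `μ_N` (no relation between `T` and the integral antidiagonal frame `A` of `H′_w` is needed).

## References
* [Rogawski1990] J. D. Rogawski, *Automorphic Representations of Unitary Groups in Three Variables*, Ann. of Math. Stud. 123 (1990), §1.10 p. 9; §4.9 Prop. 4.9.1 pp. 54–56; §12.2 p. 173.
* [Kottwitz1986] R. E. Kottwitz, *Base change for unit elements of Hecke algebras*, Compositio Math. 60 (1986), §3 (congruence filtration).
* [Jacobowitz1962] R. Jacobowitz, *Hermitian forms over local fields*, Amer. J. Math. 84 (1962), §5 (ramified case).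
* [SerreLocalFields1979] J.-P. Serre, *Local Fields*, GTM 67 (1979), Ch. IV §2 (residue field of odd characteristic, square classes).
-/

set_option autoImplicit false

noncomputable section

open MeasureTheory Measure Set Filter Topology NumberField IsDedekindDomain Matrix ValuativeRel
open scoped ENNReal NNReal Matrix MatrixGroups ValuativeRel WithZero

namespace Literature.NumberTheory.Rogawski1990

open Literature.NumberTheory.Automorphic Literature.NumberTheory.Automorphic.UnitaryGroup Literature.NumberTheory.Automorphic.IntegralReduction
open Literature.NumberTheory.GaloisRepresentations

/-! ## §1 Residue linear algebra of the rank-one label (any field) -/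

section ResidueAlgebra

variable {F : Type*} [Field F]

/-- `J · (T⁻¹ (β E₀₂) T) = β · (J T⁻¹ e₀) ⊗ row₂(T)` (outer product). [cite: Jacobowitz1962, §5] -/
theorem mul_conj_smul_single_eq_vecMulVec (J Ti Tm : Matrix (Fin 3) (Fin 3) F) (β : F) :
    J * (Ti * (β • (!![0, 0, 1; 0, 0, 0; 0, 0, 0] : Matrix (Fin 3) (Fin 3) F)) * Tm) =
      β • Matrix.vecMulVec (J *ᵥ (Ti *ᵥ Pi.single (0 : Fin 3) 1)) (fun j => Tm 2 j) := by
  ext i j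
  simp [Matrix.mul_apply, Matrix.vecMulVec_apply, Matrix.mulVec, dotProduct, Fin.sum_univ_three]
  ring

/-- The quadratic form of `β · a ⊗ b`: `z ⬝ᵥ (β a ⊗ b) z = β (a ⬝ᵥ z)(b ⬝ᵥ z)`. [cite: Jacobowitz1962, §5] -/
theorem dotProduct_smul_vecMulVec_mulVec (β : F) (a b z : Fin 3 → F) :
    z ⬝ᵥ ((β • Matrix.vecMulVec a b) *ᵥ z) = β * (a ⬝ᵥ z) * (b ⬝ᵥ z) := by
  simp [Matrix.mulVec, dotProduct, Matrix.vecMulVec_apply, Fin.sum_univ_three]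
  ring

/-- If `β · a ⊗ b` is symmetric with `β ≠ 0`, `a ≠ 0`, `b_{j₀} ≠ 0`, then `a_{j₀} ≠ 0` (`a ∥ b`). [cite: Jacobowitz1962, §5] -/
theorem apply_ne_zero_of_vecMulVec_transpose {β : F} (hβ : β ≠ 0) {a b : Fin 3 → F} (ha : a ≠ 0) {j₀ : Fin 3} (hb : b j₀ ≠ 0)
    (h : (β • Matrix.vecMulVec a b)ᵀ = β • Matrix.vecMulVec a b) : a j₀ ≠ 0 := by
  intro h0
  apply ha
  funext i
  have e := congrFun (congrFun h j₀) i
  simp only [Matrix.transpose_apply, Matrix.smul_apply, Matrix.vecMulVec_apply, smul_eq_mul, h0, zero_mul, mul_zero] at e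
  rcases mul_eq_zero.1 e with h1 | h1
  · exact absurd h1 hβ
  · rcases mul_eq_zero.1 h1 with h2 | h2
    · exact h2
    · exact absurd h2 hb

/-- `β` is a square if `β·l` and `l ≠ 0` are (square classes form a group). [cite: SerreLocalFields1979, Ch. IV §2] -/
theorem isSquare_of_isSquare_mul_right {β l : F} (hl : IsSquare l) (hl0 : l ≠ 0) (h : IsSquare (β * l)) : IsSquare β := by
  obtain ⟨r, hr⟩ := hl
  obtain ⟨s, hs⟩ := h
  have hr0 : r ≠ 0 := fun h0 => hl0 (by rw [hr, h0, mul_zero])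
  refine ⟨s * r⁻¹, ?_⟩
  calc β = β * l * l⁻¹ := by rw [mul_inv_cancel_right₀ hl0]
    _ = s * s * (r * r)⁻¹ := by rw [hs, hr]
    _ = s * r⁻¹ * (s * r⁻¹) := by rw [mul_inv]; ring

end ResidueAlgebra

/-! ## §2 The `N ∩ K₃`-average of a piece obeying the two-layer head (the `hN` socket of ★ p846921, split edition) -/

variable (L : Type) [Field L] [NumberField L] [IsCMField L] {v : HeightOneSpectrum (𝓞 ↥(maximalRealSubfield L))}
  (w : PlacesOver L v) (hw : IsCMField.complexConj L • w.1 = w.1)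

set_option maxHeartbeats 1600000 in
-- instance-term unification on the CM local carriers (as in ★ FILE L4 ∕ ★ FILE L3)
include hw in
/-- **THE `N ∩ K₃`-AVERAGE OF A `v`-LEVEL-ONE `K`-CLASS PIECE OBEYING THE TWO-LAYER (U)-ram HEAD, TAME-RAMIFIED PLACE (split edition of ★ `integral_comp_symm_eq_of_levelOne_ramified`).**
`H′` hermitian (`hH'`) with `H′_w ∈ GL₃(𝒪_w)` (`hH'w`, `hH'i`); `ψ` a level-preserving frame reading `(ψ x)_w = T x_w T⁻¹` (`T ∈ GL₃(𝒪_w)`, NO relation to `H′_w` assumed); `μ_N` ANY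
Haar measure of `N`; `ϖ ∈ L_w` with `|ϖ| = exp(−1)`, `σ_w ϖ = −ϖ`; `g` supported in `K′`, left-invariant under the `v`-level-one congruence set (`hg1`, END fold v6 :118 VERBATIM) with
the head rows `hc` (R1: boundary-regular in a `v`-deep class ↦ `c₂`), `hc′` (R2∕R3: `𝔭`-layer of rank `0 ∕ 2` ↦ `c′ 0 ∕ c′ 2`) and `hR4s ∕ hR4n` (R4□∕R4ε of
★ `exists_twoLayerStrataValues_of_levelOne_ramified_of_not_isSquare` VERBATIM with values `c₁s ∕ c₁n`: `𝔭`-layer of rank one, non-zero value of `z ↦ z ⬝ᵥ (J̄′ N(x)) *ᵥ z`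
a square ∕ a non-square).  Then **`∫_N g(ψ⁻¹ n) dμ_N = μ_N(N ∩ K₃)·(c₂(1 − q⁻¹) + q⁻¹·(c′ 2·(1 − q⁻¹) + ½(c₁s + c₁n)·q⁻¹(1 − q⁻¹) + c′ 0·q⁻²))`**, `q = N𝔭_v`.
[cite: Rogawski1990, §4.9 Prop. 4.9.1 pp. 54–56; §12.2 p. 173] [cite: Kottwitz1986, §3] [cite: Jacobowitz1962, §5] -/
theorem integral_comp_symm_eq_of_levelOne_split_ramified (H' : Matrix (Fin 3) (Fin 3) L) (hH' : (H'.map (cmConjRingHom L)).transpose = H')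
    [MeasurableSpace ↥(unitaryGroupOfForm (conjLocal L (IsCMField.complexConj L) v) (cmLocalForm L 3 v))] [BorelSpace ↥(unitaryGroupOfForm (conjLocal L (IsCMField.complexConj L) v) (cmLocalForm L 3 v))]
    (ψ : (cmDatum L 3 H').Local v ≃ₜ* ↥(unitaryGroupOfForm (conjLocal L (IsCMField.complexConj L) v) (cmLocalForm L 3 v)))
    (hψK : ∀ g : (cmDatum L 3 H').Local v, ψ g ∈ cmLocalIntegralLevel L 3 (Matrix.of fun i j : Fin 3 => if i.val + j.val + 1 = 3 then (1 : L) else 0) v ↔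
      g ∈ cmLocalIntegralLevel L 3 H' v)
    (T : GL (Fin 3) (w.1.adicCompletion L)) (hT : T ∈ glInt 3 (w.1.adicCompletion L))
    (hψT : ∀ g : (cmDatum L 3 H').Local v, localGLPiEquiv L 3 v
        (((ψ g : ↥(unitaryGroupOfForm (conjLocal L (IsCMField.complexConj L) v) (cmLocalForm L 3 v)))) : GL (Fin 3) (LocalRing L v)) w =
      T * localGLPiEquiv L 3 v (g.val : GL (Fin 3) (LocalRing L v)) w * T⁻¹)
    (he : v.asIdeal.ramificationIdx' w.1.asIdeal ≠ 1) (hH'w : IsUnit (placeForm H' w.1)) (hH'i : hH'w.unit ∈ glInt 3 (w.1.adicCompletion L))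
    {ϖ : w.1.adicCompletion L} (hϖ : Valued.v ϖ = WithZero.exp (-1 : ℤ)) (hσϖ : galAdicCompletionMap (L := L) (IsCMField.complexConj L) hw ϖ = -ϖ) (h2w : Valued.v (2 : w.1.adicCompletion L) = 1)
    [MeasurableSpace ↥(unipotentU (conjLocal L (IsCMField.complexConj L) v) (cmLocalForm L 3 v))] [BorelSpace ↥(unipotentU (conjLocal L (IsCMField.complexConj L) v) (cmLocalForm L 3 v))]
    (μN : Measure ↥(unipotentU (conjLocal L (IsCMField.complexConj L) v) (cmLocalForm L 3 v))) [μN.IsHaarMeasure]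
    (g : (cmDatum L 3 H').Local v → ℂ) (hgK : tsupport g ⊆ (cmLocalIntegralLevel L 3 H' v : Set ((cmDatum L 3 H').Local v)))
    (hg1 : ∀ u : (cmDatum L 3 H').Local v,
      (∀ a b, Valued.v (((toPlace v w (HeckeCharacter.uniformizer ↥(maximalRealSubfield L) v : v.adicCompletion ↥(maximalRealSubfield L))) ^ 1)⁻¹ *
        ((((localNonsplitEquiv (IsCMField.complexConj L) H' (IsCMField.complexConj_ne_one L) w hw (u) :
            ↥(unitaryGroupOfForm (galAdicCompletionMap (L := L) (IsCMField.complexConj L) hw) (placeForm H' w.1))) : GL (Fin 3) (w.1.adicCompletion L)) :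
              Matrix (Fin 3) (Fin 3) (w.1.adicCompletion L)) a b - (1 : Matrix (Fin 3) (Fin 3) (w.1.adicCompletion L)) a b)) ≤ 1) →
      ∀ x, g (u * x) = g x)
    (c₂ : ℂ) (c' : ℕ → ℂ) (hc : ∀ x : ((cmDatum L 3 H').Local v), (x ∈ cmLocalIntegralLevel L 3 H' v ∧ (redMat (((x).val : GL (Fin 3) (UnitaryGroup.LocalRing L v)).val.map (Pi.evalRingHom (fun w' : PlacesOver L v => w'.1.adicCompletion L) w)) - 1) ^ 3 = 0 ∧ (redMat (((x).val : GL (Fin 3) (UnitaryGroup.LocalRing L v)).val.map (Pi.evalRingHom (fun w' : PlacesOver L v => w'.1.adicCompletion L) w)) - 1).rank = 2 ∧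
        ∃ y : ((cmDatum L 3 H').Local v), (∀ a b, Valued.v (((toPlace v w (HeckeCharacter.uniformizer ↥(maximalRealSubfield L) v : v.adicCompletion ↥(maximalRealSubfield L))) ^ 1)⁻¹ *
        ((((localNonsplitEquiv (IsCMField.complexConj L) H' (IsCMField.complexConj_ne_one L) w hw (y * x * y⁻¹) :
            ↥(unitaryGroupOfForm (galAdicCompletionMap (L := L) (IsCMField.complexConj L) hw) (placeForm H' w.1))) : GL (Fin 3) (w.1.adicCompletion L)) :
              Matrix (Fin 3) (Fin 3) (w.1.adicCompletion L)) a b - (1 : Matrix (Fin 3) (Fin 3) (w.1.adicCompletion L)) a b)) ≤ 1)) → g x = c₂)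
    (hc' : ((∀ x : ((cmDatum L 3 H').Local v), (x ∈ cmLocalIntegralLevel L 3 H' v ∧ (∀ a b, Valued.v (ϖ⁻¹ * ((((x).val : GL (Fin 3) (UnitaryGroup.LocalRing L v)).val.map (Pi.evalRingHom (fun w' : PlacesOver L v => w'.1.adicCompletion L) w)) a b - (1 : Matrix (Fin 3) (Fin 3) (w.1.adicCompletion L)) a b)) ≤ 1) ∧
        (redMat (ϖ⁻¹ • ((((x).val : GL (Fin 3) (UnitaryGroup.LocalRing L v)).val.map (Pi.evalRingHom (fun w' : PlacesOver L v => w'.1.adicCompletion L) w)) - 1))) ^ 3 = 0 ∧ (redMat (ϖ⁻¹ • ((((x).val : GL (Fin 3) (UnitaryGroup.LocalRing L v)).val.map (Pi.evalRingHom (fun w' : PlacesOver L v => w'.1.adicCompletion L) w)) - 1))).rank = 0) → g x = c' 0) ∧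
      (∀ x : ((cmDatum L 3 H').Local v), (x ∈ cmLocalIntegralLevel L 3 H' v ∧ (∀ a b, Valued.v (ϖ⁻¹ * ((((x).val : GL (Fin 3) (UnitaryGroup.LocalRing L v)).val.map (Pi.evalRingHom (fun w' : PlacesOver L v => w'.1.adicCompletion L) w)) a b - (1 : Matrix (Fin 3) (Fin 3) (w.1.adicCompletion L)) a b)) ≤ 1) ∧
        (redMat (ϖ⁻¹ • ((((x).val : GL (Fin 3) (UnitaryGroup.LocalRing L v)).val.map (Pi.evalRingHom (fun w' : PlacesOver L v => w'.1.adicCompletion L) w)) - 1))) ^ 3 = 0 ∧ (redMat (ϖ⁻¹ • ((((x).val : GL (Fin 3) (UnitaryGroup.LocalRing L v)).val.map (Pi.evalRingHom (fun w' : PlacesOver L v => w'.1.adicCompletion L) w)) - 1))).rank = 2) → g x = c' 2)))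
    (c₁s c₁n : ℂ)
    (hR4s : (∀ (x : ((cmDatum L 3 H').Local v)) (z : Fin 3 → 𝓀[(w.1.adicCompletion L)]), (x ∈ cmLocalIntegralLevel L 3 H' v ∧
        (∀ a b, Valued.v (ϖ⁻¹ * ((((x).val : GL (Fin 3) (UnitaryGroup.LocalRing L v)).val.map (Pi.evalRingHom (fun w' : PlacesOver L v => w'.1.adicCompletion L) w)) a b - (1 : Matrix (Fin 3) (Fin 3) (w.1.adicCompletion L)) a b)) ≤ 1) ∧
        (redMat (ϖ⁻¹ • ((((x).val : GL (Fin 3) (UnitaryGroup.LocalRing L v)).val.map (Pi.evalRingHom (fun w' : PlacesOver L v => w'.1.adicCompletion L) w)) - 1))) ^ 3 = 0 ∧ (redMat (ϖ⁻¹ • ((((x).val : GL (Fin 3) (UnitaryGroup.LocalRing L v)).val.map (Pi.evalRingHom (fun w' : PlacesOver L v => w'.1.adicCompletion L) w)) - 1))).rank = 1 ∧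
        z ⬝ᵥ ((redMat (placeForm H' w.1) * redMat (ϖ⁻¹ • ((((x).val : GL (Fin 3) (UnitaryGroup.LocalRing L v)).val.map (Pi.evalRingHom (fun w' : PlacesOver L v => w'.1.adicCompletion L) w)) - 1))) *ᵥ z) ≠ 0 ∧ IsSquare (z ⬝ᵥ ((redMat (placeForm H' w.1) * redMat (ϖ⁻¹ • ((((x).val : GL (Fin 3) (UnitaryGroup.LocalRing L v)).val.map (Pi.evalRingHom (fun w' : PlacesOver L v => w'.1.adicCompletion L) w)) - 1))) *ᵥ z))) →
        g x = c₁s))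
    (hR4n : (∀ (x : ((cmDatum L 3 H').Local v)) (z : Fin 3 → 𝓀[(w.1.adicCompletion L)]), (x ∈ cmLocalIntegralLevel L 3 H' v ∧
        (∀ a b, Valued.v (ϖ⁻¹ * ((((x).val : GL (Fin 3) (UnitaryGroup.LocalRing L v)).val.map (Pi.evalRingHom (fun w' : PlacesOver L v => w'.1.adicCompletion L) w)) a b - (1 : Matrix (Fin 3) (Fin 3) (w.1.adicCompletion L)) a b)) ≤ 1) ∧
        (redMat (ϖ⁻¹ • ((((x).val : GL (Fin 3) (UnitaryGroup.LocalRing L v)).val.map (Pi.evalRingHom (fun w' : PlacesOver L v => w'.1.adicCompletion L) w)) - 1))) ^ 3 = 0 ∧ (redMat (ϖ⁻¹ • ((((x).val : GL (Fin 3) (UnitaryGroup.LocalRing L v)).val.map (Pi.evalRingHom (fun w' : PlacesOver L v => w'.1.adicCompletion L) w)) - 1))).rank = 1 ∧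
        z ⬝ᵥ ((redMat (placeForm H' w.1) * redMat (ϖ⁻¹ • ((((x).val : GL (Fin 3) (UnitaryGroup.LocalRing L v)).val.map (Pi.evalRingHom (fun w' : PlacesOver L v => w'.1.adicCompletion L) w)) - 1))) *ᵥ z) ≠ 0 ∧ ¬ IsSquare (z ⬝ᵥ ((redMat (placeForm H' w.1) * redMat (ϖ⁻¹ • ((((x).val : GL (Fin 3) (UnitaryGroup.LocalRing L v)).val.map (Pi.evalRingHom (fun w' : PlacesOver L v => w'.1.adicCompletion L) w)) - 1))) *ᵥ z))) →
        g x = c₁n)) :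
    ∫ n, g (ψ.symm (n : ↥(unitaryGroupOfForm (conjLocal L (IsCMField.complexConj L) v) (cmLocalForm L 3 v)))) ∂μN =
      (μN.real {n : ↥(unipotentU (conjLocal L (IsCMField.complexConj L) v) (cmLocalForm L 3 v)) | (n : ↥(unitaryGroupOfForm (conjLocal L (IsCMField.complexConj L) v) (cmLocalForm L 3 v))) ∈ cmLocalIntegralLevel L 3 (Matrix.of fun i j : Fin 3 => if i.val + j.val + 1 = 3 then (1 : L) else 0) v} : ℂ) *
        (c₂ * (1 - (Ideal.absNorm v.asIdeal : ℂ)⁻¹) +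
          (Ideal.absNorm v.asIdeal : ℂ)⁻¹ * (c' 2 * (1 - (Ideal.absNorm v.asIdeal : ℂ)⁻¹) + 2⁻¹ * (c₁s + c₁n) * ((Ideal.absNorm v.asIdeal : ℂ)⁻¹ * (1 - (Ideal.absNorm v.asIdeal : ℂ)⁻¹)) +
            c' 0 * ((Ideal.absNorm v.asIdeal : ℂ) ^ 2)⁻¹)) := by
  have hcne := IsCMField.complexConj_ne_one L
  haveI : Finite (Valued.ResidueField (w.1.adicCompletion L)) := finite_residueField_adicCompletion L w.1
  haveI : Finite 𝓀[(w.1.adicCompletion L)] := finite_residueField_of_compatible (K := w.1.adicCompletion L)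
  have hF := ringChar_residueField_ne_two L v w hw h2w
  obtain ⟨t, d, hd, ha', hb', ht2⟩ := exists_torusU_regular_twoDeep_of_ramified L w hw he h2w
  obtain ⟨hF₅, hF₃, hI₁, hF₁, hF₀⟩ := apply_symm_torus_mul_levelTwo_values_split_of_ramified L w hw H' ψ hψK T hT hψT he hϖ h2w t hd ha' hb' ht2 g hgK c₂ c' hc hc'
  -- the auxiliary torus element is `v`-level deep, so `ψ⁻¹ t` lies in the `hg1` set and `g(ψ⁻¹(t n)) = g(ψ⁻¹ n)`
  have htd : ∀ i : Fin 3, Valued.v ((((d i : (LocalRing L v)ˣ) : LocalRing L v) w) - 1) ≤ Valued.v (toPlace v w (HeckeCharacter.uniformizer ↥(maximalRealSubfield L) v : v.adicCompletion ↥(maximalRealSubfield L))) := fun i => by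
    rw [(valued_toPlace_uniformizer_of_ramified L (IsCMField.complexConj L) (IsCMField.complexConj_ne_one L) w hw he).1]; exact ht2 i
  have hshift : ∀ n : ↥(unipotentU (conjLocal L (IsCMField.complexConj L) v) (cmLocalForm L 3 v)), g (ψ.symm ((t : ↥(unitaryGroupOfForm (conjLocal L (IsCMField.complexConj L) v) (cmLocalForm L 3 v))) * (n : ↥(unitaryGroupOfForm (conjLocal L (IsCMField.complexConj L) v) (cmLocalForm L 3 v))))) = g (ψ.symm (n : ↥(unitaryGroupOfForm (conjLocal L (IsCMField.complexConj L) v) (cmLocalForm L 3 v)))) := fun n => by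
    rw [map_mul]
    exact hg1 _ (valued_symm_torus_sub_one_le L w hw H' ψ T hT hψT t hd htd) _
  -- residue data of the frame: `red T · red T⁻¹ = 1`, a non-zero entry `b_{j₀}` of `row₂ red(T)`
  obtain ⟨hvT, hvTi⟩ := valBound_coe_and_inv_of_mem_glInt L w hT
  have hTTi : redMat (T : Matrix (Fin 3) (Fin 3) (w.1.adicCompletion L)) * redMat ((T⁻¹ : GL (Fin 3) (w.1.adicCompletion L)) : Matrix (Fin 3) (Fin 3) (w.1.adicCompletion L)) = 1 := by
    rw [← redMat_mul hvT hvTi, Units.mul_inv, redMat_one]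
  obtain ⟨j₀, hj₀⟩ : ∃ j : Fin 3, redMat (T : Matrix (Fin 3) (Fin 3) (w.1.adicCompletion L)) 2 j ≠ 0 := by
    by_contra hall
    have hall' : ∀ j : Fin 3, redMat (T : Matrix (Fin 3) (Fin 3) (w.1.adicCompletion L)) 2 j = 0 := fun j => by
      by_contra h; exact hall ⟨j, h⟩
    have e := congrFun (congrFun hTTi 2) 2
    rw [Matrix.mul_apply, Matrix.one_apply_eq] at e
    simp only [hall', zero_mul, Finset.sum_const_zero] at e
    exact zero_ne_one e
  -- residue data of `H′_w`: `J̄′` invertible and symmetric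
  have hHO : ∀ i j, (placeForm H' w.1) i j ∈ 𝒪[w.1.adicCompletion L] := fun i j => ((mem_glInt_iff _).1 hH'i).1 i j
  have hHi : ValBound 1 (placeForm H' w.1) := fun i j => (Valuation.mem_integer_iff _ _).1 (hHO i j)
  have hHinv : ValBound 1 (((hH'w.unit⁻¹ : (Matrix (Fin 3) (Fin 3) (w.1.adicCompletion L))ˣ)) : Matrix (Fin 3) (Fin 3) (w.1.adicCompletion L)) := fun i j =>
    (Valuation.mem_integer_iff _ _).1 (((mem_glInt_iff _).1 hH'i).2 i j)
  have hJJ : redMat (placeForm H' w.1) * redMat (((hH'w.unit⁻¹ : (Matrix (Fin 3) (Fin 3) (w.1.adicCompletion L))ˣ)) : Matrix (Fin 3) (Fin 3) (w.1.adicCompletion L)) = 1 := by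
    rw [← redMat_mul hHi hHinv]
    have hmi := hH'w.unit.mul_inv
    rw [hH'w.unit_spec] at hmi
    rw [hmi, redMat_one]
  have hJdet : (redMat (placeForm H' w.1)).det ≠ 0 := (Matrix.isUnit_det_of_right_inverse hJJ).ne_zero
  have hJt : (redMat (placeForm H' w.1))ᵀ = redMat (placeForm H' w.1) := by
    have h2 := congrArg redMat (placeForm_hermitian_of_smul_eq (c := IsCMField.complexConj L) w H' hH' hw)
    rwa [redMat_transpose, redMat_map_galAdicCompletionMap_eq_of_ramified L v w hw he hHO] at h2
  have ha0 : (redMat (placeForm H' w.1) *ᵥ (redMat ((T⁻¹ : GL (Fin 3) (w.1.adicCompletion L)) : Matrix (Fin 3) (Fin 3) (w.1.adicCompletion L)) *ᵥ Pi.single (0 : Fin 3) 1)) ≠ 0 := by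
    intro h0
    have h1 := Matrix.eq_zero_of_mulVec_eq_zero hJdet h0
    have h2 : redMat (T : Matrix (Fin 3) (Fin 3) (w.1.adicCompletion L)) *ᵥ (redMat ((T⁻¹ : GL (Fin 3) (w.1.adicCompletion L)) : Matrix (Fin 3) (Fin 3) (w.1.adicCompletion L)) *ᵥ Pi.single (0 : Fin 3) (1 : 𝓀[(w.1.adicCompletion L)])) = Pi.single (0 : Fin 3) 1 := by
      rw [Matrix.mulVec_mulVec, hTTi, Matrix.one_mulVec]
    rw [h1, Matrix.mulVec_zero] at h2
    have h3 := congrFun h2 0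
    rw [Pi.zero_apply, Pi.single_eq_same] at h3
    exact zero_ne_one h3
  -- the rank-one interior stratum: the label is `β·λ` with the frame constant `λ = a_{j₀}/b_{j₀}`, and the head values by square class
  have hI : ∀ n : ↥(unipotentU (conjLocal L (IsCMField.complexConj L) v) (cmLocalForm L 3 v)), (n : ↥(unitaryGroupOfForm (conjLocal L (IsCMField.complexConj L) v) (cmLocalForm L 3 v))) ∈ cmLocalIntegralLevel L 3 (Matrix.of fun i j : Fin 3 => if i.val + j.val + 1 = 3 then (1 : L) else 0) v → (redMat (((n : ↥(unitaryGroupOfForm (conjLocal L (IsCMField.complexConj L) v) (cmLocalForm L 3 v))) : GL (Fin 3) (LocalRing L v)).val.map (Pi.evalRingHom (fun w' : PlacesOver L v => w'.1.adicCompletion L) w)) - 1).rank = 0 → (redMat (ϖ⁻¹ • ((((n : ↥(unitaryGroupOfForm (conjLocal L (IsCMField.complexConj L) v) (cmLocalForm L 3 v))) : GL (Fin 3) (LocalRing L v)).val.map (Pi.evalRingHom (fun w' : PlacesOver L v => w'.1.adicCompletion L) w)) - 1))).rank = 1 →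
      (IsSquare ((redMat (placeForm H' w.1) *ᵥ (redMat ((T⁻¹ : GL (Fin 3) (w.1.adicCompletion L)) : Matrix (Fin 3) (Fin 3) (w.1.adicCompletion L)) *ᵥ Pi.single (0 : Fin 3) 1)) j₀ * (redMat (T : Matrix (Fin 3) (Fin 3) (w.1.adicCompletion L)) 2 j₀)⁻¹) → (IsSquare (red (ϖ⁻¹ * (((n : ↥(unitaryGroupOfForm (conjLocal L (IsCMField.complexConj L) v) (cmLocalForm L 3 v))) : GL (Fin 3) (LocalRing L v)).val.map (Pi.evalRingHom (fun w' : PlacesOver L v => w'.1.adicCompletion L) w)) 0 2)) → g (ψ.symm (n : ↥(unitaryGroupOfForm (conjLocal L (IsCMField.complexConj L) v) (cmLocalForm L 3 v)))) = c₁s) ∧ (¬ IsSquare (red (ϖ⁻¹ * (((n : ↥(unitaryGroupOfForm (conjLocal L (IsCMField.complexConj L) v) (cmLocalForm L 3 v))) : GL (Fin 3) (LocalRing L v)).val.map (Pi.evalRingHom (fun w' : PlacesOver L v => w'.1.adicCompletion L) w)) 0 2)) → g (ψ.symm (n : ↥(unitaryGroupOfForm (conjLocal L (IsCMField.complexConj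 L) v) (cmLocalForm L 3 v)))) = c₁n)) ∧
      (¬ IsSquare ((redMat (placeForm H' w.1) *ᵥ (redMat ((T⁻¹ : GL (Fin 3) (w.1.adicCompletion L)) : Matrix (Fin 3) (Fin 3) (w.1.adicCompletion L)) *ᵥ Pi.single (0 : Fin 3) 1)) j₀ * (redMat (T : Matrix (Fin 3) (Fin 3) (w.1.adicCompletion L)) 2 j₀)⁻¹) → (IsSquare (red (ϖ⁻¹ * (((n : ↥(unitaryGroupOfForm (conjLocal L (IsCMField.complexConj L) v) (cmLocalForm L 3 v))) : GL (Fin 3) (LocalRing L v)).val.map (Pi.evalRingHom (fun w' : PlacesOver L v => w'.1.adicCompletion L) w)) 0 2)) → g (ψ.symm (n : ↥(unitaryGroupOfForm (conjLocal L (IsCMField.complexConj L) v) (cmLocalForm L 3 v)))) = c₁n) ∧ (¬ IsSquare (red (ϖ⁻¹ * (((n : ↥(unitaryGroupOfForm (conjLocal L (IsCMField.complexConj L) v) (cmLocalForm L 3 v))) : GL (Fin 3) (LocalRing L v)).val.map (Pi.evalRingHom (fun w' : PlacesOver L v => w'.1.adicCompletion L) w)) 0 2)) → g (ψ.symm (n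 : ↥(unitaryGroupOfForm (conjLocal L (IsCMField.complexConj L) v) (cmLocalForm L 3 v)))) = c₁s)) := by
    intro n hn h0 hs
    obtain ⟨hkK, hkint, hk3, hkr, hNk⟩ := hI₁ n hn h0 hs
    obtain ⟨hNn, hβ0⟩ := redMat_smul_sub_one_eq_smul_of_rank_eq_one L w hw hϖ h2w n hn h0 hs
    have hsym := redMat_placeForm_mul_depthOne_eq_transpose_mul_of_ramified L H' w hw he hH'w hH'i ϖ hϖ hσϖ hkK hkint
    have hJN : redMat (placeForm H' w.1) * redMat (ϖ⁻¹ • ((((ψ.symm ((t : ↥(unitaryGroupOfForm (conjLocal L (IsCMField.complexConj L) v) (cmLocalForm L 3 v))) * (n : ↥(unitaryGroupOfForm (conjLocal L (IsCMField.complexConj L) v) (cmLocalForm L 3 v))))).val : GL (Fin 3) (UnitaryGroup.LocalRing L v)).val.map (Pi.evalRingHom (fun w' : PlacesOver L v => w'.1.adicCompletion L) w)) - 1)) =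
        red (ϖ⁻¹ * (((n : ↥(unitaryGroupOfForm (conjLocal L (IsCMField.complexConj L) v) (cmLocalForm L 3 v))) : GL (Fin 3) (LocalRing L v)).val.map (Pi.evalRingHom (fun w' : PlacesOver L v => w'.1.adicCompletion L) w)) 0 2) • Matrix.vecMulVec (redMat (placeForm H' w.1) *ᵥ (redMat ((T⁻¹ : GL (Fin 3) (w.1.adicCompletion L)) : Matrix (Fin 3) (Fin 3) (w.1.adicCompletion L)) *ᵥ Pi.single (0 : Fin 3) 1)) (fun j => redMat (T : Matrix (Fin 3) (Fin 3) (w.1.adicCompletion L)) 2 j) := by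
      rw [hNk, hNn, mul_conj_smul_single_eq_vecMulVec]
    have hVt : (red (ϖ⁻¹ * (((n : ↥(unitaryGroupOfForm (conjLocal L (IsCMField.complexConj L) v) (cmLocalForm L 3 v))) : GL (Fin 3) (LocalRing L v)).val.map (Pi.evalRingHom (fun w' : PlacesOver L v => w'.1.adicCompletion L) w)) 0 2) • Matrix.vecMulVec (redMat (placeForm H' w.1) *ᵥ (redMat ((T⁻¹ : GL (Fin 3) (w.1.adicCompletion L)) : Matrix (Fin 3) (Fin 3) (w.1.adicCompletion L)) *ᵥ Pi.single (0 : Fin 3) 1)) (fun j => redMat (T : Matrix (Fin 3) (Fin 3) (w.1.adicCompletion L)) 2 j))ᵀ =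
        red (ϖ⁻¹ * (((n : ↥(unitaryGroupOfForm (conjLocal L (IsCMField.complexConj L) v) (cmLocalForm L 3 v))) : GL (Fin 3) (LocalRing L v)).val.map (Pi.evalRingHom (fun w' : PlacesOver L v => w'.1.adicCompletion L) w)) 0 2) • Matrix.vecMulVec (redMat (placeForm H' w.1) *ᵥ (redMat ((T⁻¹ : GL (Fin 3) (w.1.adicCompletion L)) : Matrix (Fin 3) (Fin 3) (w.1.adicCompletion L)) *ᵥ Pi.single (0 : Fin 3) 1)) (fun j => redMat (T : Matrix (Fin 3) (Fin 3) (w.1.adicCompletion L)) 2 j) := by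
      rw [← hJN, Matrix.transpose_mul, hJt, ← hsym]
    have haj := apply_ne_zero_of_vecMulVec_transpose hβ0 ha0 hj₀ hVt
    have hl0 : ((redMat (placeForm H' w.1) *ᵥ (redMat ((T⁻¹ : GL (Fin 3) (w.1.adicCompletion L)) : Matrix (Fin 3) (Fin 3) (w.1.adicCompletion L)) *ᵥ Pi.single (0 : Fin 3) 1)) j₀ * (redMat (T : Matrix (Fin 3) (Fin 3) (w.1.adicCompletion L)) 2 j₀)⁻¹) ≠ 0 := mul_ne_zero haj (inv_ne_zero hj₀)
    have hQ : ((redMat (T : Matrix (Fin 3) (Fin 3) (w.1.adicCompletion L)) 2 j₀)⁻¹ • (Pi.single j₀ 1 : Fin 3 → 𝓀[(w.1.adicCompletion L)])) ⬝ᵥ ((redMat (placeForm H' w.1) * redMat (ϖ⁻¹ • ((((ψ.symm ((t : ↥(unitaryGroupOfForm (conjLocal L (IsCMField.complexConj L) v) (cmLocalForm L 3 v))) * (n : ↥(unitaryGroupOfForm (conjLocal L (IsCMField.complexConj L) v) (cmLocalForm L 3 v))))).val : GL (Fin 3) (UnitaryGroup.LocalRing L v)).val.map (Pi.evalRingHom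 (fun w' : PlacesOver L v => w'.1.adicCompletion L) w)) - 1))) *ᵥ ((redMat (T : Matrix (Fin 3) (Fin 3) (w.1.adicCompletion L)) 2 j₀)⁻¹ • (Pi.single j₀ 1 : Fin 3 → 𝓀[(w.1.adicCompletion L)]))) =
        red (ϖ⁻¹ * (((n : ↥(unitaryGroupOfForm (conjLocal L (IsCMField.complexConj L) v) (cmLocalForm L 3 v))) : GL (Fin 3) (LocalRing L v)).val.map (Pi.evalRingHom (fun w' : PlacesOver L v => w'.1.adicCompletion L) w)) 0 2) * ((redMat (placeForm H' w.1) *ᵥ (redMat ((T⁻¹ : GL (Fin 3) (w.1.adicCompletion L)) : Matrix (Fin 3) (Fin 3) (w.1.adicCompletion L)) *ᵥ Pi.single (0 : Fin 3) 1)) j₀ * (redMat (T : Matrix (Fin 3) (Fin 3) (w.1.adicCompletion L)) 2 j₀)⁻¹) := by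
      rw [hJN, dotProduct_smul_vecMulVec_mulVec, dotProduct_smul, dotProduct_smul, dotProduct_single, dotProduct_single, smul_eq_mul, smul_eq_mul, mul_one, mul_one,
        inv_mul_cancel₀ hj₀]
      ring
    have hQne : ((redMat (T : Matrix (Fin 3) (Fin 3) (w.1.adicCompletion L)) 2 j₀)⁻¹ • (Pi.single j₀ 1 : Fin 3 → 𝓀[(w.1.adicCompletion L)])) ⬝ᵥ ((redMat (placeForm H' w.1) * redMat (ϖ⁻¹ • ((((ψ.symm ((t : ↥(unitaryGroupOfForm (conjLocal L (IsCMField.complexConj L) v) (cmLocalForm L 3 v))) * (n : ↥(unitaryGroupOfForm (conjLocal L (IsCMField.complexConj L) v) (cmLocalForm L 3 v))))).val : GL (Fin 3) (UnitaryGroup.LocalRing L v)).val.map (Pi.evalRingHom (fun w' : PlacesOver L v => w'.1.adicCompletion L) w)) - 1))) *ᵥ ((redMat (T : Matrix (Fin 3) (Fin 3) (w.1.adicCompletion L)) 2 j₀)⁻¹ • (Pi.single j₀ 1 : Fin 3 → 𝓀[(w.1.adicCompletion L)]))) ≠ 0 := by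
      rw [hQ]; exact mul_ne_zero hβ0 hl0
    have hgs : IsSquare (red (ϖ⁻¹ * (((n : ↥(unitaryGroupOfForm (conjLocal L (IsCMField.complexConj L) v) (cmLocalForm L 3 v))) : GL (Fin 3) (LocalRing L v)).val.map (Pi.evalRingHom (fun w' : PlacesOver L v => w'.1.adicCompletion L) w)) 0 2) * ((redMat (placeForm H' w.1) *ᵥ (redMat ((T⁻¹ : GL (Fin 3) (w.1.adicCompletion L)) : Matrix (Fin 3) (Fin 3) (w.1.adicCompletion L)) *ᵥ Pi.single (0 : Fin 3) 1)) j₀ * (redMat (T : Matrix (Fin 3) (Fin 3) (w.1.adicCompletion L)) 2 j₀)⁻¹)) → g (ψ.symm (n : ↥(unitaryGroupOfForm (conjLocal L (IsCMField.complexConj L) v) (cmLocalForm L 3 v)))) = c₁s := fun h => by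
      rw [← hshift]; exact hR4s _ _ ⟨hkK, hkint, hk3, hkr, hQne, by rw [hQ]; exact h⟩
    have hgn : ¬ IsSquare (red (ϖ⁻¹ * (((n : ↥(unitaryGroupOfForm (conjLocal L (IsCMField.complexConj L) v) (cmLocalForm L 3 v))) : GL (Fin 3) (LocalRing L v)).val.map (Pi.evalRingHom (fun w' : PlacesOver L v => w'.1.adicCompletion L) w)) 0 2) * ((redMat (placeForm H' w.1) *ᵥ (redMat ((T⁻¹ : GL (Fin 3) (w.1.adicCompletion L)) : Matrix (Fin 3) (Fin 3) (w.1.adicCompletion L)) *ᵥ Pi.single (0 : Fin 3) 1)) j₀ * (redMat (T : Matrix (Fin 3) (Fin 3) (w.1.adicCompletion L)) 2 j₀)⁻¹)) → g (ψ.symm (n : ↥(unitaryGroupOfForm (conjLocal L (IsCMField.complexConj L) v) (cmLocalForm L 3 v)))) = c₁n := fun h => by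
      rw [← hshift]; exact hR4n _ _ ⟨hkK, hkint, hk3, hkr, hQne, by rw [hQ]; exact h⟩
    refine ⟨fun hl => ⟨fun hb => hgs (hb.mul hl), fun hb => hgn fun h => hb (isSquare_of_isSquare_mul_right hl hl0 h)⟩,
      fun hl => ⟨fun hb => hgn fun h => (isSquare_mul_iff_of_not_isSquare hF hl hβ0).1 (by rwa [mul_comm] at h) hb,
        fun hb => hgs (by rw [mul_comm]; exact (isSquare_mul_iff_of_not_isSquare hF hl hβ0).2 hb)⟩⟩
  by_cases hl : IsSquare ((redMat (placeForm H' w.1) *ᵥ (redMat ((T⁻¹ : GL (Fin 3) (w.1.adicCompletion L)) : Matrix (Fin 3) (Fin 3) (w.1.adicCompletion L)) *ᵥ Pi.single (0 : Fin 3) 1)) j₀ * (redMat (T : Matrix (Fin 3) (Fin 3) (w.1.adicCompletion L)) 2 j₀)⁻¹)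
  · exact integral_eq_of_levelTwo_strata_split_of_ramified L v w hw μN hϖ he h2w (c' 0) c₁s c₁n (c' 2) c₂ _
      (fun n hn hr => by rw [← hshift]; exact hF₅ n hn hr) (fun n hn h0 hs => by rw [← hshift]; exact hF₃ n hn h0 hs)
      (fun n hn h0 hs hsq => ((hI n hn h0 hs).1 hl).1 hsq) (fun n hn h0 hs hns => ((hI n hn h0 hs).1 hl).2 hns)
      (fun n hn h0 hs => by rw [← hshift]; exact hF₁ n hn h0 hs) (fun n hn => by rw [← hshift]; exact hF₀ n hn)
  · rw [add_comm c₁s c₁n]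
    exact integral_eq_of_levelTwo_strata_split_of_ramified L v w hw μN hϖ he h2w (c' 0) c₁n c₁s (c' 2) c₂ _
      (fun n hn hr => by rw [← hshift]; exact hF₅ n hn hr) (fun n hn h0 hs => by rw [← hshift]; exact hF₃ n hn h0 hs)
      (fun n hn h0 hs hsq => ((hI n hn h0 hs).2 hl).1 hsq) (fun n hn h0 hs hns => ((hI n hn h0 hs).2 hl).2 hns)
      (fun n hn h0 hs => by rw [← hshift]; exact hF₁ n hn h0 hs) (fun n hn => by rw [← hshift]; exact hF₀ n hn)

end Literature.NumberTheory.Rogawski1990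

end
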